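import Summits.NavierStokesRegularity.NavierStokesRegularity.Theorems.FilamentSkeletonRssDefectColumnGateDefsR
import HarnessLib.Audit

/-!
# Route `FilamentSkeletonRss` · ∀-crux `TransverseReduction1AR` (stmt-NavierStokesRegularity-23611) · line `defect_column_gate_1AR` →
# «A1R-acc» (reduction MODULO ACCRETION MODES over the core-area box; director-ns dss_120/122 KEEP-R4 branch): the LINE-SIDE VOCABULARY, v3

Definitions only (never asserted), `--supports stmt-NavierStokesRegularity-23611 --as helper`; LEAD of 23611, lane ns-filament-21221-p1 g13.  Supersedes the
files-only DRAFT v2 (`Cruxes/TransverseReductionRJ/Lines/defect_column_gate_1AR_acc_DRAFT.lean`, 3e409639, namespace `…AccDraft`).  Aligned to tenure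
g26's route-side kit v3/v4 (`TransverseReduction1ARaccDraft.sig` 85f2378e6097f7ce, `SkeletonBoxR.sig` 460b8c928573f50d, critic (k2) MET 23:18:20Z) with
ONE LEAD reconciliation point, **R7**: in the ∀-item's per-`(p, β)` block the regularity is `ContDiff ℝ 2 (U p β) ∧ ContDiff ℝ 1 (P p β)` (as in
`AlmostConcl1AG`), NOT `C^∞` — smoothness is recovered by the GLUE at the selected zero `(p⋆, β⋆)`, where the equation is exact (`F = 0`), through the
landed ladder `Theorems.KelvinGate.Smoothing.contDiff_velocity_infty / contDiff_pressure_infty` (exactly as `lineGlue1AR` does today); asking `C^∞` at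
every `(p, β)` would force the ∀-side to certify `C^∞` of the accretion modes `D_pj` (the `DefD` formula, removable singularity on the tangent line) and of
the rate column `Zr`, for no use.  Everything else is tenure's text: abstract rate window `β ∈ [−1, 1]` with output rate `αo p β` (R1), `Zr` free (R2/K2-2),
export law division-free `k₀ ≤ k ∧ Γ·|B − k·F⁰| ≤ Ce` with `k₀, Ce, Γ₁` bound BEFORE `Γ` (R3/K2-1), joint continuity of `(g, B)` only (R4), rate faces
`g p (−1) < 0 < g p 1` as ∀-side OUTPUT (R5), `F⁰ = (3/2 − w′_pj(c_pj))·Aa_pj(c_pj) + 4` (D6), `D` = RJ's `DefD` (D7).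

Contents.  §0 the p-FAMILY hypothesis block of the acc-crux (`BoxDefU1 … BoxDefD1`, `BoxClauses1R` = joint continuity clause + `Clauses1R` at every `p` of
the cube — character-identical to tenure's block after unfolding) and its conclusion block `BoxConclAcc`; `CutFormAcc` (to be certified `↔` the route decl
by `Iff.rfl` once tenure files it).  §1 the line's specs over the box: `areaDefect`, `FamilySpecAcc` (S1-acc output: `FamilySpec1AG` at every `p` with the
residual split `r + g·Z + Σ_j G_j·D_j`, the exported affine law on `G`, a UNIFORM orientation of the rate defect, joint local continuity in `(p, β)`),
`DefectGateSpecAcc` (S2-acc output: right inverse bordered by `Z` AND the `N` modes, bound / linearity per `(p, β)`, tightness UNIFORM on the box,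
local continuity in `(p, β)`).  §2 the stub statements `DefectFamilyAcc` (S1-acc), `DefectGateAcc` + `GateAssemblyLocAcc := WaistColumnGateLoc1A →
DefectGateAcc` (S2a-loc unchanged + S2b-acc), `DefectClosingAcc` (S3-acc: NO intermediate-value theorem inside — the Miranda selection lives in the
route-level glue, `Theorems/…AccretionBoxMiranda.lean` p678153).  HONEST FRAMING: bookkeeping for a HYPOTHETICAL filament-type rotating-self-similar
blow-up route (MODEL rung, negative side); nothing here bears on Navier–Stokes regularity; no item is proved, refuted or filed by this file.
-/

set_option linter.dupNamespace false

noncomputable section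

namespace Summit.NavierStokesRegularity.NavierStokesRegularity.Theorems.DefectColumnGate

open scoped BigOperators Topology Manifold Classical MeasureTheory ProbabilityTheory Matrix InnerProductSpace ComplexConjugate ContinuousMap ENNReal ContDiff
open Filter Set Function TopologicalSpace MeasureTheory
open Literature.NS
open Literature.Analysis.FluidPDE
open Summit.NavierStokesRegularity.NavierStokesRegularity.Theses.FilamentSkeletonRss
open Summit.NavierStokesRegularity.NavierStokesRegularity.Theorems.KelvinGate (lerayOp lerayLin XBound YBound LocClose)

/-! ## 0. The acc-crux, cut at its arrows (p-families over the core-area box `{p : Fin N → ℝ | ∀ i, p i ∈ Icc 0 1}`) -/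

/-- Defining hypothesis 1 over the box: `DefU1` at every `p`. -/
def BoxDefU1 (N : ℕ) (Γ : ℝ) (γ : (Fin N → ℝ) → Fin N → ℝ) (Aa : (Fin N → ℝ) → Fin N → ℝ → ℝ)
    (u : (Fin N → ℝ) → (Fin N → ℝ → EuclideanSpace ℝ (Fin 3)) → EuclideanSpace ℝ (Fin 3) → EuclideanSpace ℝ (Fin 3)) : Prop :=
  ∀ p, DefU1 N Γ (γ p) (Aa p) (u p)

/-- Defining hypothesis 2 over the box: `DefV1` at every `p`. -/
def BoxDefV1 (N : ℕ) (α : (Fin N → ℝ) → ℝ) (X : (Fin N → ℝ) → Fin N → ℝ → EuclideanSpace ℝ (Fin 3))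
    (u : (Fin N → ℝ) → (Fin N → ℝ → EuclideanSpace ℝ (Fin 3)) → EuclideanSpace ℝ (Fin 3) → EuclideanSpace ℝ (Fin 3))
    (v : (Fin N → ℝ) → EuclideanSpace ℝ (Fin 3) → EuclideanSpace ℝ (Fin 3)) : Prop :=
  ∀ p, DefV1 N (α p) (X p) (u p) (v p)

/-- Defining hypothesis 3 over the box: `DefA1` at every `p`. -/
def BoxDefA1 (N : ℕ) (X : (Fin N → ℝ) → Fin N → ℝ → EuclideanSpace ℝ (Fin 3)) (c : (Fin N → ℝ) → Fin N → ℝ)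
    (v : (Fin N → ℝ) → EuclideanSpace ℝ (Fin 3) → EuclideanSpace ℝ (Fin 3)) (A : (Fin N → ℝ) → Fin N → (EuclideanSpace ℝ (Fin 3) →L[ℝ] EuclideanSpace ℝ (Fin 3))) : Prop :=
  ∀ p, DefA1 N (X p) (c p) (v p) (A p)

/-- Defining hypothesis 4 over the box: `DefT1` at every `p`. -/
def BoxDefT1 (N : ℕ) (α : (Fin N → ℝ) → ℝ) (u : (Fin N → ℝ) → (Fin N → ℝ → EuclideanSpace ℝ (Fin 3)) → EuclideanSpace ℝ (Fin 3) → EuclideanSpace ℝ (Fin 3))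
    (T : (Fin N → ℝ) → (Fin N → ℝ → EuclideanSpace ℝ (Fin 3)) → Fin N → ℝ → EuclideanSpace ℝ (Fin 3)) : Prop :=
  ∀ p, DefT1 N (α p) (u p) (T p)

/-- Defining hypothesis 5 over the box (RJ's `DefD` text, D7): the ACCRETION MODE of tube `j` of the skeleton at `p` — Gaussian in the axial distance,
Lamb–Oseen in the distance to the waist tangent line, azimuthal about `X_pj′(c_pj)`. -/
def BoxDefD1 (N : ℕ) (X : (Fin N → ℝ) → Fin N → ℝ → EuclideanSpace ℝ (Fin 3)) (c : (Fin N → ℝ) → Fin N → ℝ)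
    (D : (Fin N → ℝ) → Fin N → EuclideanSpace ℝ (Fin 3) → EuclideanSpace ℝ (Fin 3)) : Prop :=
  ∀ p j y, D p j y = (Real.exp (-(⟪y-X p j (c p j), deriv (X p j) (c p j)⟫_ℝ)^2)*((1-Real.exp (-(‖y-X p j (c p j)‖^2-⟪y-X p j (c p j), deriv (X p j) (c p j)⟫_ℝ^2)))/(‖y-X p j (c p j)‖^2-⟪y-X p j (c p j), deriv (X p j) (c p j)⟫_ℝ^2)))•cross (deriv (X p j) (c p j)) (y-X p j (c p j))

/-- The hypothesis CLAUSE BLOCK of the acc-crux (= `SkeletonBoxR`'s block, tenure v2 460b8c92): joint continuity of the skeleton data in `(p, τ)` on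
`cube × ℝ` (tuple incl. the waist frames `m, n`), and `Clauses1R` (13-R tail) at EVERY `p` of the cube. -/
def BoxClauses1R (N : ℕ) (Γ δ ρ K Λ a b cnd Rw Rb cg θ₀ KA : ℝ) (γ : (Fin N → ℝ) → Fin N → ℝ) (α : (Fin N → ℝ) → ℝ)
    (X : (Fin N → ℝ) → Fin N → ℝ → EuclideanSpace ℝ (Fin 3)) (w : (Fin N → ℝ) → Fin N → ℝ → ℝ) (c : (Fin N → ℝ) → Fin N → ℝ)
    (m n : (Fin N → ℝ) → Fin N → EuclideanSpace ℝ (Fin 3)) (Aa : (Fin N → ℝ) → Fin N → ℝ → ℝ) (v : (Fin N → ℝ) → EuclideanSpace ℝ (Fin 3) → EuclideanSpace ℝ (Fin 3))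
    (A : (Fin N → ℝ) → Fin N → (EuclideanSpace ℝ (Fin 3) →L[ℝ] EuclideanSpace ℝ (Fin 3)))
    (T : (Fin N → ℝ) → (Fin N → ℝ → EuclideanSpace ℝ (Fin 3)) → Fin N → ℝ → EuclideanSpace ℝ (Fin 3)) : Prop :=
  (∀ j, ContinuousOn (fun q:(Fin N→ℝ) × ℝ => (α q.1, γ q.1 j, c q.1 j, X q.1 j q.2, w q.1 j q.2, Aa q.1 j q.2, m q.1 j, n q.1 j)) ({p:Fin N → ℝ | ∀ i, p i ∈ Icc 0 1} ×ˢ univ)) ∧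
  (∀ p:Fin N → ℝ, (∀ i, p i ∈ Icc 0 1) → Clauses1R N Γ δ ρ K Λ a b cnd Rw Rb cg θ₀ KA (γ p) (α p) (X p) (w p) (c p) (m p) (n p) (Aa p) (v p) (A p) (T p))

/-- The UNPAID PASSIVE AREA LAW of a rigid core of area `A` at a waist with axial strain `w′(c)`: `F⁰(A) = (3/2 − w′(c))·A + 4` (D6: the route's area-law conjunct
`w·Aa′ = (3/2 − w′)·Aa + 4` of `Clauses1G`, at the waist `w = 0`).  Slope `≤ −δ` under the waist clause; zero at the matched area `A* = 4/(w′(c) − 3/2)`. -/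
def areaDefect (wc A : ℝ) : ℝ := (3 / 2 - wc) * A + 4

/-- The CONCLUSION BLOCK of the acc-crux for candidate outputs `(C₀, M, αo, g, B, k, Zr, U, P)` over the box times the abstract rate window `[−1, 1]` (tenure v3
text with R7: `C²/C¹` regularity per `(p, β)`): joint continuity of `(g, B)`; rate faces; at every `(p, β)` the profile equation at rate `αo p β ≠ 0` MODULO the rate
mode `Zr` and the `N` accretion modes `D_pj`, with Type-I / pressure / waist envelopes, and the EXPORTED affine area law `k₀ ≤ k ∧ Γ·|B − k·F⁰| ≤ Ce`. -/
def BoxConclAcc (N : ℕ) (Γ ρ η Rw k₀ Ce : ℝ) (X : (Fin N → ℝ) → Fin N → ℝ → EuclideanSpace ℝ (Fin 3)) (w : (Fin N → ℝ) → Fin N → ℝ → ℝ) (c : (Fin N → ℝ) → Fin N → ℝ)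
    (Aa : (Fin N → ℝ) → Fin N → ℝ → ℝ) (u : (Fin N → ℝ) → (Fin N → ℝ → EuclideanSpace ℝ (Fin 3)) → EuclideanSpace ℝ (Fin 3) → EuclideanSpace ℝ (Fin 3))
    (D : (Fin N → ℝ) → Fin N → EuclideanSpace ℝ (Fin 3) → EuclideanSpace ℝ (Fin 3)) (C₀ M : ℝ) (αo g : (Fin N → ℝ) → ℝ → ℝ) (B k : (Fin N → ℝ) → ℝ → Fin N → ℝ)
    (Zr U : (Fin N → ℝ) → ℝ → EuclideanSpace ℝ (Fin 3) → EuclideanSpace ℝ (Fin 3)) (P : (Fin N → ℝ) → ℝ → EuclideanSpace ℝ (Fin 3) → ℝ) : Prop :=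
  ContinuousOn (fun q:(Fin N→ℝ) × ℝ => (g q.1 q.2, B q.1 q.2)) ({p:Fin N → ℝ | ∀ i, p i ∈ Icc 0 1} ×ˢ Icc (-1) 1) ∧
  (∀ p:Fin N → ℝ, (∀ i, p i ∈ Icc 0 1) → g p (-1) < 0 ∧ 0 < g p 1) ∧
  (∀ (p:Fin N → ℝ) (β:ℝ), (∀ i, p i ∈ Icc 0 1) → β ∈ Icc (-1) 1 → αo p β ≠ 0 ∧ U p β ≠ 0 ∧ ContDiff ℝ 2 (U p β) ∧ ContDiff ℝ 1 (P p β) ∧ VectorCalculus.IsDivFree (U p β)∧(∀ y, αo p β•(cross (EuclideanSpace.single 2 1) (U p β y)-fderiv ℝ (U p β) y (cross (EuclideanSpace.single 2 1) y))+(1/2:ℝ)•U p β y+(1/2:ℝ)•fderiv ℝ (U p β) y y-(Laplacian.laplacian (U p β)) y+fderiv ℝ (U p β) y (U p β y)+gradient (P p β) y = g p β•Zr p β y+∑ j, B p β j•D p j y)∧(∀ y, ‖U p β y‖≤C₀/(1+‖y‖))∧(∀ y, |P p β y|≤M)∧(∀ y, ‖y‖≤Rw*√Γ → (∀ j τ,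 ρ*√Γ/4≤‖y-X p j τ‖) → ‖U p β y-u p (X p) y‖≤η*√Γ)∧(∀ j, k₀≤k p β j ∧ Γ*|B p β j-k p β j*areaDefect (deriv (w p j) (c p j)) (Aa p j (c p j))|≤Ce))

/-- The CUT FORM of the acc-crux `TransverseReduction1ARacc` (tenure draft v3 + R7): for all box constants there are EXPORT constants `k₀ > 0, Ce` and a threshold
`Γ₁` (uniform: bound before `Γ` and the family, K2-1) such that every admissible p-family of clause-13-R skeleta carries outputs satisfying `BoxConclAcc`.
To be certified `TransverseReduction1ARacc ↔ CutFormAcc := Iff.rfl` when the item is filed. -/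
abbrev CutFormAcc : Prop :=
  ∀ (N : ℕ) (δ ρ K Λ a b cnd η Rw Rb cg θ₀ KA : ℝ), 0 < N → 0 < δ → 0 < ρ → 0 ≤ a → 0 < η → 0 < Rw → 0 < Rb → 0 < cg → 0 < θ₀ →
    ∃ (k₀ Ce Γ₁ : ℝ), 0 < k₀ ∧ ∀ Γ : ℝ, Γ₁ ≤ Γ →
    ∀ (γ : (Fin N → ℝ) → Fin N → ℝ) (α : (Fin N → ℝ) → ℝ) (X : (Fin N → ℝ) → Fin N → ℝ → EuclideanSpace ℝ (Fin 3)) (w : (Fin N → ℝ) → Fin N → ℝ → ℝ)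
      (c : (Fin N → ℝ) → Fin N → ℝ) (m n : (Fin N → ℝ) → Fin N → EuclideanSpace ℝ (Fin 3)) (Aa : (Fin N → ℝ) → Fin N → ℝ → ℝ)
      (u : (Fin N → ℝ) → (Fin N → ℝ → EuclideanSpace ℝ (Fin 3)) → EuclideanSpace ℝ (Fin 3) → EuclideanSpace ℝ (Fin 3))
      (v : (Fin N → ℝ) → EuclideanSpace ℝ (Fin 3) → EuclideanSpace ℝ (Fin 3)) (A : (Fin N → ℝ) → Fin N → (EuclideanSpace ℝ (Fin 3) →L[ℝ] EuclideanSpace ℝ (Fin 3)))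
      (T : (Fin N → ℝ) → (Fin N → ℝ → EuclideanSpace ℝ (Fin 3)) → Fin N → ℝ → EuclideanSpace ℝ (Fin 3))
      (D : (Fin N → ℝ) → Fin N → EuclideanSpace ℝ (Fin 3) → EuclideanSpace ℝ (Fin 3)),
      BoxDefU1 N Γ γ Aa u → BoxDefV1 N α X u v → BoxDefA1 N X c v A → BoxDefT1 N α u T → BoxDefD1 N X c D →
      BoxClauses1R N Γ δ ρ K Λ a b cnd Rw Rb cg θ₀ KA γ α X w c m n Aa v A T →
      ∃ (C₀ M : ℝ) (αo g : (Fin N → ℝ) → ℝ → ℝ) (B k : (Fin N → ℝ) → ℝ → Fin N → ℝ) (Zr U : (Fin N → ℝ) → ℝ → EuclideanSpace ℝ (Fin 3) → EuclideanSpace ℝ (Fin 3))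
        (P : (Fin N → ℝ) → ℝ → EuclideanSpace ℝ (Fin 3) → ℝ), BoxConclAcc N Γ ρ η Rw k₀ Ce X w c Aa u D C₀ M αo g B k Zr U P

/-! ## 1. The specs of the line over the box -/

/-- **Spec of S1-acc · RE-WOUND DEFECT FAMILY of order `k` OVER THE BOX, residual split modulo the `N + 1` modes.**  For every `p` in the cube: `FamilySpec1AG`'s
clauses at the skeleton `p` (base rate `α⁰_p`, physical window `|β| ≤ β₀` with `0 < β₀ ≤ min(θ₀/4, 2Γ^(−q₁))` UNIFORM in `p`, smooth divergence-free `U⁰_{p,β}`,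
size `Cs·Γ⁴`, non-degenerate, waist-close, compactly supported rate column `Z_{p,β} = 𝓡U⁰_{p,β}` in the doubled ball), EXCEPT that the profile equation at rate
`α⁰_p + β` holds up to `r + g·Z + Σ_j G_j·D_pj` with `Y(r) ≤ C_r·Γ^(−k)`, `|g| ≤ Cs·Γ^(−q₁)`, and accretion coefficients obeying the EXPORTED affine area law
`k₀ ≤ kA ∧ Γ·|G_j − kA_j·F⁰_pj| ≤ Cs` (R3; `F⁰_pj = areaDefect (w′_pj(c_pj)) (Aa_pj(c_pj))`); the rate defect has ONE orientation on the whole box with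
margin `Γ^(−q₁)` at `β = ∓β₀`; and `(U⁰, Z, r, g, G)` are locally continuous in `(p, β)` jointly (sup on balls for the fields). -/
def FamilySpecAcc (N : ℕ) (Γ ρ η Rw Rb θ₀ k₀ : ℝ) (k : ℕ) (Cs Cr q₁ : ℝ)
    (α : (Fin N → ℝ) → ℝ) (X : (Fin N → ℝ) → Fin N → ℝ → EuclideanSpace ℝ (Fin 3)) (w : (Fin N → ℝ) → Fin N → ℝ → ℝ) (c : (Fin N → ℝ) → Fin N → ℝ)
    (Aa : (Fin N → ℝ) → Fin N → ℝ → ℝ) (u : (Fin N → ℝ) → (Fin N → ℝ → EuclideanSpace ℝ (Fin 3)) → EuclideanSpace ℝ (Fin 3) → EuclideanSpace ℝ (Fin 3))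
    (D : (Fin N → ℝ) → Fin N → EuclideanSpace ℝ (Fin 3) → EuclideanSpace ℝ (Fin 3))
    (α0 : (Fin N → ℝ) → ℝ) (β₀ : ℝ) (U0 : (Fin N → ℝ) → ℝ → EuclideanSpace ℝ (Fin 3) → EuclideanSpace ℝ (Fin 3)) (P0 : (Fin N → ℝ) → ℝ → EuclideanSpace ℝ (Fin 3) → ℝ)
    (Z : (Fin N → ℝ) → ℝ → EuclideanSpace ℝ (Fin 3) → EuclideanSpace ℝ (Fin 3)) (g : (Fin N → ℝ) → ℝ → ℝ) (G kA : (Fin N → ℝ) → ℝ → Fin N → ℝ)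
    (r : (Fin N → ℝ) → ℝ → EuclideanSpace ℝ (Fin 3) → EuclideanSpace ℝ (Fin 3)) : Prop :=
  0 < β₀ ∧ β₀ ≤ θ₀ / 4 ∧ β₀ ≤ 2 * Γ ^ (-q₁) ∧
  ((∀ p : Fin N → ℝ, (∀ i, p i ∈ Icc (0:ℝ) 1) → g p (-β₀) ≤ -Γ ^ (-q₁) ∧ Γ ^ (-q₁) ≤ g p β₀) ∨
    (∀ p : Fin N → ℝ, (∀ i, p i ∈ Icc (0:ℝ) 1) → g p β₀ ≤ -Γ ^ (-q₁) ∧ Γ ^ (-q₁) ≤ g p (-β₀))) ∧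
  ∀ p : Fin N → ℝ, (∀ i, p i ∈ Icc (0:ℝ) 1) →
    |α0 p - α p| ≤ θ₀ / 4 ∧
    (∀ β : ℝ, |β| ≤ β₀ →
      ContDiff ℝ (⊤:ℕ∞) (U0 p β) ∧ ContDiff ℝ (⊤:ℕ∞) (P0 p β) ∧ VectorCalculus.IsDivFree (U0 p β) ∧
      XBound (U0 p β) (Cs * Γ ^ 4) ∧ (∀ y, |P0 p β y| ≤ Cs * Γ ^ 4) ∧ (∃ y₀, ‖y₀‖ ≤ Cs ∧ 1 ≤ ‖U0 p β y₀‖) ∧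
      (∀ y, ‖y‖ ≤ Rw * √Γ → (∀ j τ, ρ * √Γ / 4 ≤ ‖y - X p j τ‖) → ‖U0 p β y - u p (X p) y‖ ≤ η * √Γ / 2) ∧
      YBound (Z p β) (Cs * Γ ^ 6) ∧ (∀ y, ‖y‖ ≤ 2 * Rb * √(Γ * Real.log Γ) → Z p β y = rateGen (U0 p β) y) ∧
      (∀ y, 4 * Rb * √(Γ * Real.log Γ) ≤ ‖y‖ → Z p β y = 0) ∧
      YBound (r p β) (Cr * Γ ^ (-(k:ℝ))) ∧ |g p β| ≤ Cs * Γ ^ (-q₁) ∧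
      (∀ j, k₀ ≤ kA p β j ∧ Γ * |G p β j - kA p β j * areaDefect (deriv (w p j) (c p j)) (Aa p j (c p j))| ≤ Cs) ∧
      (∀ y, lerayOp (α0 p + β) (U0 p β) y + gradient (P0 p β) y = r p β y + g p β • Z p β y + ∑ j, G p β j • D p j y)) ∧
    (∀ β : ℝ, |β| ≤ β₀ → ∀ L ε : ℝ, 0 < ε → ∃ δ' : ℝ, 0 < δ' ∧ ∀ p' : Fin N → ℝ, (∀ i, p' i ∈ Icc (0:ℝ) 1) → ∀ β' : ℝ, |β'| ≤ β₀ →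
      dist p' p < δ' → |β' - β| < δ' →
      LocClose (U0 p' β') (U0 p β) L ε ∧ LocClose (Z p' β') (Z p β) L ε ∧ (∀ y, ‖y‖ ≤ L → ‖r p' β' y - r p β y‖ ≤ ε) ∧
        |g p' β' - g p β| ≤ ε ∧ ∀ j, |G p' β' j - G p β j| ≤ ε)

/-- **Spec of S2-acc · GATE BORDERED BY THE RATE COLUMN AND THE `N` ACCRETION MODES, over the box.**  At every `(p, β)`: a RIGHT INVERSE
`F ↦ (𝓚F, 𝓠F, 𝓫F, 𝓬F)` of the linearised profile operator at `(α⁰_p + β, U⁰_{p,β})` bordered on the range side by `Z_{p,β}` and `D_{p,1…N}`: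
`𝓛(𝓚F) + ∇(𝓠F) + (𝓫F)·Z + Σ_j (𝓬F)_j·D_pj = F`, `div 𝓚F = 0`, all outputs `≤ C₂Γ^κ·Y(F)` (1), linear in `F` (2); TIGHT uniformly on the box (3); locally continuous in
`(p, β)` at fixed data (4).  By R4's count the `N + 1` borders span the near-cokernel, so (1) on ALL of `Y` is the honest expectation here. -/
def DefectGateSpecAcc (N : ℕ) (Γ κ C₂ β₀ : ℝ) (α0 : (Fin N → ℝ) → ℝ) (U0 : (Fin N → ℝ) → ℝ → EuclideanSpace ℝ (Fin 3) → EuclideanSpace ℝ (Fin 3))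
    (Z : (Fin N → ℝ) → ℝ → EuclideanSpace ℝ (Fin 3) → EuclideanSpace ℝ (Fin 3)) (D : (Fin N → ℝ) → Fin N → EuclideanSpace ℝ (Fin 3) → EuclideanSpace ℝ (Fin 3))
    (𝓚 : (Fin N → ℝ) → ℝ → (EuclideanSpace ℝ (Fin 3) → EuclideanSpace ℝ (Fin 3)) → EuclideanSpace ℝ (Fin 3) → EuclideanSpace ℝ (Fin 3))
    (𝓠 : (Fin N → ℝ) → ℝ → (EuclideanSpace ℝ (Fin 3) → EuclideanSpace ℝ (Fin 3)) → EuclideanSpace ℝ (Fin 3) → ℝ)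
    (𝓫 : (Fin N → ℝ) → ℝ → (EuclideanSpace ℝ (Fin 3) → EuclideanSpace ℝ (Fin 3)) → ℝ)
    (𝓬 : (Fin N → ℝ) → ℝ → (EuclideanSpace ℝ (Fin 3) → EuclideanSpace ℝ (Fin 3)) → Fin N → ℝ) : Prop :=
  (∀ p : Fin N → ℝ, (∀ i, p i ∈ Icc (0:ℝ) 1) → ∀ β : ℝ, |β| ≤ β₀ →
    (∀ (F : EuclideanSpace ℝ (Fin 3) → EuclideanSpace ℝ (Fin 3)) (R : ℝ), YBound F R →
        XBound (𝓚 p β F) (C₂ * Γ ^ κ * R) ∧ ContDiff ℝ 1 (𝓠 p β F) ∧ (∀ y, |𝓠 p β F y| ≤ C₂ * Γ ^ κ * R) ∧ |𝓫 p β F| ≤ C₂ * Γ ^ κ * R ∧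
        (∀ j, |𝓬 p β F j| ≤ C₂ * Γ ^ κ * R) ∧ VectorCalculus.IsDivFree (𝓚 p β F) ∧
        ∀ y, lerayLin (α0 p + β) (U0 p β) (𝓚 p β F) y + gradient (𝓠 p β F) y + 𝓫 p β F • Z p β y + ∑ j, 𝓬 p β F j • D p j y = F y) ∧
    (∀ (F H : EuclideanSpace ℝ (Fin 3) → EuclideanSpace ℝ (Fin 3)) (s : ℝ), (∃ R, YBound F R) → (∃ R, YBound H R) →
        (𝓚 p β (fun y => F y + s • H y) = fun y => 𝓚 p β F y + s • 𝓚 p β H y) ∧ 𝓫 p β (fun y => F y + s • H y) = 𝓫 p β F + s * 𝓫 p β H ∧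
        ∀ j, 𝓬 p β (fun y => F y + s • H y) j = 𝓬 p β F j + s * 𝓬 p β H j)) ∧
  (∀ R L ε : ℝ, 0 < ε → ∃ L' δ₀ : ℝ, 0 < δ₀ ∧ ∀ p : Fin N → ℝ, (∀ i, p i ∈ Icc (0:ℝ) 1) → ∀ β : ℝ, |β| ≤ β₀ →
      ∀ F : EuclideanSpace ℝ (Fin 3) → EuclideanSpace ℝ (Fin 3), YBound F R → (∀ y, ‖y‖ ≤ L' → ‖F y‖ ≤ δ₀) →
        (∀ y, ‖y‖ ≤ L → ‖𝓚 p β F y‖ ≤ ε ∧ ‖fderiv ℝ (𝓚 p β F) y‖ ≤ ε) ∧ |𝓫 p β F| ≤ ε ∧ ∀ j, |𝓬 p β F j| ≤ ε) ∧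
  (∀ p : Fin N → ℝ, (∀ i, p i ∈ Icc (0:ℝ) 1) → ∀ β : ℝ, |β| ≤ β₀ → ∀ (F : EuclideanSpace ℝ (Fin 3) → EuclideanSpace ℝ (Fin 3)) (R L ε : ℝ),
      YBound F R → 0 < ε → ∃ δ' : ℝ, 0 < δ' ∧ ∀ p' : Fin N → ℝ, (∀ i, p' i ∈ Icc (0:ℝ) 1) → ∀ β' : ℝ, |β'| ≤ β₀ → dist p' p < δ' → |β' - β| < δ' →
        LocClose (𝓚 p' β' F) (𝓚 p β F) L ε ∧ |𝓫 p' β' F - 𝓫 p β F| ≤ ε ∧ ∀ j, |𝓬 p' β' F j - 𝓬 p β F j| ≤ ε)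

/-! ## 2. The statements of the acc-line (S2a-loc `WaistColumnGateLoc1A` is reused unchanged, clause-free) -/

/-- **Statement of stub S1-acc · `DefectFamilyAcc`** (size XL): existence of the re-wound defect family over the box, with a size constant `Cs` and an export gain
`k₀ > 0` uniform in the requested window exponent `q₁` and order `k` (the residual constant `C_r` and the threshold `Γ₁` may depend on them). -/
def DefectFamilyAcc : Prop :=
  ∀ (N : ℕ) (δ ρ K Λ a b cnd η Rw Rb cg θ₀ KA : ℝ), 0 < N → 0 < δ → 0 < ρ → 0 ≤ a → 0 < η → 0 < Rw → 0 < Rb → 0 < cg → 0 < θ₀ →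
    ∃ Cs k₀ : ℝ, 0 < k₀ ∧ ∀ (q₁ : ℝ) (k : ℕ), ∃ Cr Γ₁ : ℝ, ∀ Γ : ℝ, Γ₁ ≤ Γ →
    ∀ (γ : (Fin N → ℝ) → Fin N → ℝ) (α : (Fin N → ℝ) → ℝ) (X : (Fin N → ℝ) → Fin N → ℝ → EuclideanSpace ℝ (Fin 3)) (w : (Fin N → ℝ) → Fin N → ℝ → ℝ)
      (c : (Fin N → ℝ) → Fin N → ℝ) (m n : (Fin N → ℝ) → Fin N → EuclideanSpace ℝ (Fin 3)) (Aa : (Fin N → ℝ) → Fin N → ℝ → ℝ)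
      (u : (Fin N → ℝ) → (Fin N → ℝ → EuclideanSpace ℝ (Fin 3)) → EuclideanSpace ℝ (Fin 3) → EuclideanSpace ℝ (Fin 3))
      (v : (Fin N → ℝ) → EuclideanSpace ℝ (Fin 3) → EuclideanSpace ℝ (Fin 3)) (A : (Fin N → ℝ) → Fin N → (EuclideanSpace ℝ (Fin 3) →L[ℝ] EuclideanSpace ℝ (Fin 3)))
      (T : (Fin N → ℝ) → (Fin N → ℝ → EuclideanSpace ℝ (Fin 3)) → Fin N → ℝ → EuclideanSpace ℝ (Fin 3))
      (D : (Fin N → ℝ) → Fin N → EuclideanSpace ℝ (Fin 3) → EuclideanSpace ℝ (Fin 3)),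
      BoxDefU1 N Γ γ Aa u → BoxDefV1 N α X u v → BoxDefA1 N X c v A → BoxDefT1 N α u T → BoxDefD1 N X c D →
      BoxClauses1R N Γ δ ρ K Λ a b cnd Rw Rb cg θ₀ KA γ α X w c m n Aa v A T →
      ∃ (α0 : (Fin N → ℝ) → ℝ) (β₀ : ℝ) (U0 : (Fin N → ℝ) → ℝ → EuclideanSpace ℝ (Fin 3) → EuclideanSpace ℝ (Fin 3)) (P0 : (Fin N → ℝ) → ℝ → EuclideanSpace ℝ (Fin 3) → ℝ)
        (Z : (Fin N → ℝ) → ℝ → EuclideanSpace ℝ (Fin 3) → EuclideanSpace ℝ (Fin 3)) (g : (Fin N → ℝ) → ℝ → ℝ) (G kA : (Fin N → ℝ) → ℝ → Fin N → ℝ)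
        (r : (Fin N → ℝ) → ℝ → EuclideanSpace ℝ (Fin 3) → EuclideanSpace ℝ (Fin 3)),
        FamilySpecAcc N Γ ρ η Rw Rb θ₀ k₀ k Cs Cr q₁ α X w c Aa u D α0 β₀ U0 P0 Z g G kA r

/-- **Conclusion of stub S2b-acc · `DefectGateAcc`**: around EVERY defect family over the box with window exponent `q₁ ≥ q₀` and order `k ≥ k₀'` there is a gate
bordered by the rate column and the `N` modes (spec `DefectGateSpecAcc`), with exponent `κ` and constant `C₂` depending on the box constants, `Cs` and `k₀` only. -/
def DefectGateAcc : Prop :=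
  ∀ (N : ℕ) (δ ρ K Λ a b cnd η Rw Rb cg θ₀ KA : ℝ), 0 < N → 0 < δ → 0 < ρ → 0 ≤ a → 0 < η → 0 < Rw → 0 < Rb → 0 < cg → 0 < θ₀ →
    ∀ Cs k₀ : ℝ, ∃ κ C₂ q₀ : ℝ, ∃ k₀' : ℕ, ∀ q₁ : ℝ, q₀ ≤ q₁ → ∀ k : ℕ, k₀' ≤ k → 1 ≤ k → ∀ Cr : ℝ, ∃ Γ₁ : ℝ, ∀ Γ : ℝ, Γ₁ ≤ Γ →
    ∀ (γ : (Fin N → ℝ) → Fin N → ℝ) (α : (Fin N → ℝ) → ℝ) (X : (Fin N → ℝ) → Fin N → ℝ → EuclideanSpace ℝ (Fin 3)) (w : (Fin N → ℝ) → Fin N → ℝ → ℝ)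
      (c : (Fin N → ℝ) → Fin N → ℝ) (m n : (Fin N → ℝ) → Fin N → EuclideanSpace ℝ (Fin 3)) (Aa : (Fin N → ℝ) → Fin N → ℝ → ℝ)
      (u : (Fin N → ℝ) → (Fin N → ℝ → EuclideanSpace ℝ (Fin 3)) → EuclideanSpace ℝ (Fin 3) → EuclideanSpace ℝ (Fin 3))
      (v : (Fin N → ℝ) → EuclideanSpace ℝ (Fin 3) → EuclideanSpace ℝ (Fin 3)) (A : (Fin N → ℝ) → Fin N → (EuclideanSpace ℝ (Fin 3) →L[ℝ] EuclideanSpace ℝ (Fin 3)))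
      (T : (Fin N → ℝ) → (Fin N → ℝ → EuclideanSpace ℝ (Fin 3)) → Fin N → ℝ → EuclideanSpace ℝ (Fin 3))
      (D : (Fin N → ℝ) → Fin N → EuclideanSpace ℝ (Fin 3) → EuclideanSpace ℝ (Fin 3)),
      BoxDefU1 N Γ γ Aa u → BoxDefV1 N α X u v → BoxDefA1 N X c v A → BoxDefT1 N α u T → BoxDefD1 N X c D →
      BoxClauses1R N Γ δ ρ K Λ a b cnd Rw Rb cg θ₀ KA γ α X w c m n Aa v A T →
      ∀ (α0 : (Fin N → ℝ) → ℝ) (β₀ : ℝ) (U0 : (Fin N → ℝ) → ℝ → EuclideanSpace ℝ (Fin 3) → EuclideanSpace ℝ (Fin 3)) (P0 : (Fin N → ℝ) → ℝ → EuclideanSpace ℝ (Fin 3) → ℝ)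
        (Z : (Fin N → ℝ) → ℝ → EuclideanSpace ℝ (Fin 3) → EuclideanSpace ℝ (Fin 3)) (g : (Fin N → ℝ) → ℝ → ℝ) (G kA : (Fin N → ℝ) → ℝ → Fin N → ℝ)
        (r : (Fin N → ℝ) → ℝ → EuclideanSpace ℝ (Fin 3) → EuclideanSpace ℝ (Fin 3)),
        FamilySpecAcc N Γ ρ η Rw Rb θ₀ k₀ k Cs Cr q₁ α X w c Aa u D α0 β₀ U0 P0 Z g G kA r →
      ∃ (𝓚 : (Fin N → ℝ) → ℝ → (EuclideanSpace ℝ (Fin 3) → EuclideanSpace ℝ (Fin 3)) → EuclideanSpace ℝ (Fin 3) → EuclideanSpace ℝ (Fin 3))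
        (𝓠 : (Fin N → ℝ) → ℝ → (EuclideanSpace ℝ (Fin 3) → EuclideanSpace ℝ (Fin 3)) → EuclideanSpace ℝ (Fin 3) → ℝ)
        (𝓫 : (Fin N → ℝ) → ℝ → (EuclideanSpace ℝ (Fin 3) → EuclideanSpace ℝ (Fin 3)) → ℝ)
        (𝓬 : (Fin N → ℝ) → ℝ → (EuclideanSpace ℝ (Fin 3) → EuclideanSpace ℝ (Fin 3)) → Fin N → ℝ),
        DefectGateSpecAcc N Γ κ C₂ β₀ α0 U0 Z D 𝓚 𝓠 𝓫 𝓬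

/-- **Statement of stub S2b-acc · `GateAssemblyLocAcc`**: patching the LOCALISED sectional gate (S2a-loc `WaistColumnGateLoc1A`, clause-free, unchanged since v4)
into the gate bordered by the rate column AND the `N` waist-accretion modes (R4: these span the near-cokernel the v5/v6a one-border gate was blind to). -/
def GateAssemblyLocAcc : Prop :=
  WaistColumnGateLoc1A → DefectGateAcc

/-- **Statement of stub S3-acc · `DefectClosingAcc`** (size L; frozen contraction at each `(p, β)` + JOINT CONTINUITY of the `N + 1` multipliers + export transfer;
NO intermediate-value theorem — the Miranda selection is the route-level glue).  Given `Cs`, `k₀ > 0`, the gate's `κ, C₂` and ANY thresholds `q₀, k₀'`, SOME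
`q₁ ≥ q₀` and `k ≥ k₀'` suffice: for every family of that order over the box and every bordered gate around it, for `Γ ≥ Γ₁`, the outputs
`αo := α⁰_p + β₀b`, `U := U⁰ + 𝓚G`, `P := P⁰ + 𝓠G`, `(g', B) := ±(g − 𝓫G, ·), (G_j − 𝓬_jG)_j`, `Zr := ±Z` (sign = the family's orientation), `k := kA`
satisfy `BoxConclAcc` with export constants `(k₀, Cs + 1)`, where `G_{p,β}` is the Picard fixed point `G = −r − D(𝓚G)[𝓚G]` in the `2C_rΓ^(−k)`-ball. -/
def DefectClosingAcc : Prop :=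
  ∀ (N : ℕ) (δ ρ K Λ a b cnd η Rw Rb cg θ₀ KA : ℝ), 0 < N → 0 < δ → 0 < ρ → 0 ≤ a → 0 < η → 0 < Rw → 0 < Rb → 0 < cg → 0 < θ₀ →
    ∀ Cs k₀ κ C₂ q₀ : ℝ, ∀ k₀' : ℕ, 0 < k₀ → ∃ q₁ : ℝ, q₀ ≤ q₁ ∧ ∃ k : ℕ, k₀' ≤ k ∧ 1 ≤ k ∧ ∀ Cr : ℝ, ∃ Γ₁ : ℝ, ∀ Γ : ℝ, Γ₁ ≤ Γ →
    ∀ (γ : (Fin N → ℝ) → Fin N → ℝ) (α : (Fin N → ℝ) → ℝ) (X : (Fin N → ℝ) → Fin N → ℝ → EuclideanSpace ℝ (Fin 3)) (w : (Fin N → ℝ) → Fin N → ℝ → ℝ)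
      (c : (Fin N → ℝ) → Fin N → ℝ) (m n : (Fin N → ℝ) → Fin N → EuclideanSpace ℝ (Fin 3)) (Aa : (Fin N → ℝ) → Fin N → ℝ → ℝ)
      (u : (Fin N → ℝ) → (Fin N → ℝ → EuclideanSpace ℝ (Fin 3)) → EuclideanSpace ℝ (Fin 3) → EuclideanSpace ℝ (Fin 3))
      (v : (Fin N → ℝ) → EuclideanSpace ℝ (Fin 3) → EuclideanSpace ℝ (Fin 3)) (A : (Fin N → ℝ) → Fin N → (EuclideanSpace ℝ (Fin 3) →L[ℝ] EuclideanSpace ℝ (Fin 3)))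
      (T : (Fin N → ℝ) → (Fin N → ℝ → EuclideanSpace ℝ (Fin 3)) → Fin N → ℝ → EuclideanSpace ℝ (Fin 3))
      (D : (Fin N → ℝ) → Fin N → EuclideanSpace ℝ (Fin 3) → EuclideanSpace ℝ (Fin 3)),
      BoxDefU1 N Γ γ Aa u → BoxDefV1 N α X u v → BoxDefA1 N X c v A → BoxDefT1 N α u T → BoxDefD1 N X c D →
      BoxClauses1R N Γ δ ρ K Λ a b cnd Rw Rb cg θ₀ KA γ α X w c m n Aa v A T →
      ∀ (α0 : (Fin N → ℝ) → ℝ) (β₀ : ℝ) (U0 : (Fin N → ℝ) → ℝ → EuclideanSpace ℝ (Fin 3) → EuclideanSpace ℝ (Fin 3)) (P0 : (Fin N → ℝ) → ℝ → EuclideanSpace ℝ (Fin 3) → ℝ)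
        (Z : (Fin N → ℝ) → ℝ → EuclideanSpace ℝ (Fin 3) → EuclideanSpace ℝ (Fin 3)) (g : (Fin N → ℝ) → ℝ → ℝ) (G kA : (Fin N → ℝ) → ℝ → Fin N → ℝ)
        (r : (Fin N → ℝ) → ℝ → EuclideanSpace ℝ (Fin 3) → EuclideanSpace ℝ (Fin 3)),
        FamilySpecAcc N Γ ρ η Rw Rb θ₀ k₀ k Cs Cr q₁ α X w c Aa u D α0 β₀ U0 P0 Z g G kA r →
      ∀ (𝓚 : (Fin N → ℝ) → ℝ → (EuclideanSpace ℝ (Fin 3) → EuclideanSpace ℝ (Fin 3)) → EuclideanSpace ℝ (Fin 3) → EuclideanSpace ℝ (Fin 3))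
        (𝓠 : (Fin N → ℝ) → ℝ → (EuclideanSpace ℝ (Fin 3) → EuclideanSpace ℝ (Fin 3)) → EuclideanSpace ℝ (Fin 3) → ℝ)
        (𝓫 : (Fin N → ℝ) → ℝ → (EuclideanSpace ℝ (Fin 3) → EuclideanSpace ℝ (Fin 3)) → ℝ)
        (𝓬 : (Fin N → ℝ) → ℝ → (EuclideanSpace ℝ (Fin 3) → EuclideanSpace ℝ (Fin 3)) → Fin N → ℝ),
        DefectGateSpecAcc N Γ κ C₂ β₀ α0 U0 Z D 𝓚 𝓠 𝓫 𝓬 →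
      ∃ (C₀ M : ℝ) (αo g' : (Fin N → ℝ) → ℝ → ℝ) (B k' : (Fin N → ℝ) → ℝ → Fin N → ℝ) (Zr U : (Fin N → ℝ) → ℝ → EuclideanSpace ℝ (Fin 3) → EuclideanSpace ℝ (Fin 3))
        (P : (Fin N → ℝ) → ℝ → EuclideanSpace ℝ (Fin 3) → ℝ), BoxConclAcc N Γ ρ η Rw k₀ (Cs + 1) X w c Aa u D C₀ M αo g' B k' Zr U P

end Summit.NavierStokesRegularity.NavierStokesRegularity.Theorems.DefectColumnGate

end


/-!
# DRAFT skeleton v7 «defect_column_gate_1AR_acc» for the FUTURE ∀-crux `TransverseReduction1ARacc` (not yet filed; director-ns dss_120/122: design first)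

LEAD ns-filament-21221-p1 g13.  Files-only: this DRAFT registers nothing (the acc-crux has no item yet; v6a edd27d8e stays 23611's skeleton of record).
It shows the composition `S1-acc → (S2a-loc → S2b-acc) → S3-acc → CutFormAcc` is PURE LOGIC over the v3 vocabulary (`…DefsRacc`), with S3-acc already PROVED
(`Theorems/…ClosingAcc.lean`, to be proposed with the vocabulary) — on the day the item is filed, `TransverseReduction1ARacc_of := (Iff.rfl).mpr (lineGlueAcc …)`
concludes the crux BY NAME with sorries only in `stub_defectFamilyAcc` (S1-acc, XL), `stub_waistColumnGateLoc1A` (S2a-loc, s2aloc lineage), `stub_gateAssemblyLocAcc`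
(S2b-acc).  HONEST FRAMING: bookkeeping for a HYPOTHETICAL blow-up route (MODEL rung, negative side); nothing here bears on Navier–Stokes regularity.
-/

set_option linter.dupNamespace false

noncomputable section

namespace Summit.NavierStokesRegularity.NavierStokesRegularity.Cruxes.TransverseReduction1ARacc.DefectColumnGate

open scoped BigOperators Topology InnerProductSpace ContDiff
open Filter Set Function MeasureTheory
open Literature.Analysis.FluidPDE
open Summit.NavierStokesRegularity.NavierStokesRegularity.Theses.FilamentSkeletonRss
open Summit.NavierStokesRegularity.NavierStokesRegularity.Theorems.KelvinGate (lerayOp lerayLin XBound YBound LocClose)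
open Summit.NavierStokesRegularity.NavierStokesRegularity.Theorems.DefectColumnGate

/-- **Stub S1-acc** (`DefectFamilyAcc`, XL). -/
theorem stub_defectFamilyAcc : DefectFamilyAcc := by
  sorry

/-- **Stub S2a-loc** (`WaistColumnGateLoc1A`) — UNCHANGED since v4 (clause-free; s2aloc lineage's bricks). -/
theorem stub_waistColumnGateLoc1A : WaistColumnGateLoc1A := by
  sorry

/-- **Stub S2b-acc** (`GateAssemblyLocAcc = WaistColumnGateLoc1A → DefectGateAcc`) — patching into the gate bordered by the rate column AND the N accretion modes. -/
theorem stub_gateAssemblyLocAcc : GateAssemblyLocAcc := by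
  sorry

/-- **Stub S3-acc** (`DefectClosingAcc`) — PROVED (`Theorems/FilamentSkeletonRssDefectColumnGateClosingAcc.lean`, `stub_defectClosingAcc`); restated as a sorry here ONLY
because this DRAFT cannot import the not-yet-landed proof file. -/
theorem stub_defectClosingAcc : DefectClosingAcc := by
  sorry

/-- **Glue (pure logic, no sorry)**: the three acc-stubs give the cut form, with export constants `(k₀, Cs + 1)` read from S1-acc. -/
theorem lineGlueAcc (h1 : DefectFamilyAcc) (h2 : DefectGateAcc) (h3 : DefectClosingAcc) : CutFormAcc := by
  intro N δ ρ K Λ a b cnd η Rw Rb cg θ₀ KA hN hδ hρ ha hη hRw hRb hcg hθ₀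
  obtain ⟨Cs, k₀, hk₀, hS1⟩ := h1 N δ ρ K Λ a b cnd η Rw Rb cg θ₀ KA hN hδ hρ ha hη hRw hRb hcg hθ₀
  obtain ⟨κ, C₂, q₀, k₀', hS2⟩ := h2 N δ ρ K Λ a b cnd η Rw Rb cg θ₀ KA hN hδ hρ ha hη hRw hRb hcg hθ₀ Cs k₀
  obtain ⟨q₁, hq, k, hkk, hk1, hS3⟩ := h3 N δ ρ K Λ a b cnd η Rw Rb cg θ₀ KA hN hδ hρ ha hη hRw hRb hcg hθ₀ Cs k₀ κ C₂ q₀ k₀' hk₀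
  obtain ⟨Cr, Γa, hS1'⟩ := hS1 q₁ k
  obtain ⟨Γb, hS2'⟩ := hS2 q₁ hq k hkk hk1 Cr
  obtain ⟨Γc, hS3'⟩ := hS3 Cr
  refine ⟨k₀, Cs + 1, max Γa (max Γb Γc), hk₀, ?_⟩
  intro Γ hΓ γ α X w c m n Aa u v A T D hu hv hA hT hD hcl
  have hΓa : Γa ≤ Γ := le_trans (le_max_left _ _) hΓ
  have hΓb : Γb ≤ Γ := le_trans (le_trans (le_max_left _ _) (le_max_right _ _)) hΓ
  have hΓc : Γc ≤ Γ := le_trans (le_trans (le_max_right _ _) (le_max_right _ _)) hΓ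
  obtain ⟨α0, β₀, U0, P0, Z, g, G, kA, r, hfam⟩ := hS1' Γ hΓa γ α X w c m n Aa u v A T D hu hv hA hT hD hcl
  obtain ⟨𝓚, 𝓠, 𝓫, 𝓬, hgate⟩ := hS2' Γ hΓb γ α X w c m n Aa u v A T D hu hv hA hT hD hcl α0 β₀ U0 P0 Z g G kA r hfam
  exact hS3' Γ hΓc γ α X w c m n Aa u v A T D hu hv hA hT hD hcl α0 β₀ U0 P0 Z g G kA r hfam 𝓚 𝓠 𝓫 𝓬 hgate

/-- **The skeleton (A12 shape) up to the missing route decl**: `CutFormAcc` from the registered-to-be stubs; on filing,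
`TransverseReduction1ARacc_of := transverseReduction1ARacc_iff.mpr cutFormAcc_of_stubs`. -/
theorem cutFormAcc_of_stubs : CutFormAcc :=
  lineGlueAcc stub_defectFamilyAcc (stub_gateAssemblyLocAcc stub_waistColumnGateLoc1A) stub_defectClosingAcc

end Summit.NavierStokesRegularity.NavierStokesRegularity.Cruxes.TransverseReduction1ARacc.DefectColumnGate

end

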